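import Summits.ResolutionOfSingularities.ResolutionOfSingularities.Theorems.EquisingularLiftEquisingularLiftNatLiftableNoseThenPoints
import Summits.ResolutionOfSingularities.ResolutionOfSingularities.Theorems.EquisingularLiftEquisingularLiftNatRatLiftLiftableCentre
import HarnessLib

/-!
# [OURS · L1 W4.5(b) · EL♮(3)] DOWNSTAIRS PREDICATE for the successor of the v6‴ rung — the liftable nose class WITH RATIONAL CURVES
# `IsLiftableNoseClass₂` (`base` = lead-2's v1 class ci / det / union, `rat` = closed-immersion images of `ℙ^r_k` by forms of one degree,
# `union` = disjoint unions) — DEFS ONLY (lift + closer: `…NatLiftableNoseClass2ThenPoints.lean`)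

Cell `res-hironaka`, rung L, slot W4.5(b); crux **EL♮(3)** (stmt-ResolutionOfSingularities-20148) / EL♮ (stmt-20038); residue `stub_elnat_three_nonisolated_nonliftclass`
of skeleton v11 / child v8 after the v6‴ rung `stub_elnat_liftableNoseThenPoints` (CLOSED p531946). res-L1-w45b-lead-2's plan 2026-08-27T12:22:39Z
(«rational curves … are added as a successor predicate, append-only») and res-type-051's DESIGN INPUT 12:56:42Z. OURS; NOT a statement of any
manuscript; AI-written, weaker than expert review. DRAFT — the successor lead owns the Defs / the registered text; this file shows that the
proposed `rat` data block is PURELY ALGEBRAIC DOWNSTAIRS DATA and that the class lifts: `rat` ↦ res-type-032's `RatLift.isLiftableCentre_of_forms`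
(T-RATLIFT-ALG parts 1–5 ∘ res-type-051's `SatLift.liftableCentre_of_saturatedLift` p530902) with its `hZreg` input DISCHARGED by res-type-051's
T-RATREG `RatReg.isRegular_subscheme_vanishingIdeal_of_clause'` (p534148); `base` ↦ `lift_of_isLiftableNoseClass` (p531946); `union` ↦
`liftableCentre_union` (p531946). No `sorry`, standard axioms.
-/

set_option linter.dupNamespace false

noncomputable section

open CategoryTheory AlgebraicGeometry TopologicalSpace MvPolynomial

namespace Summit.ResolutionOfSingularities.ResolutionOfSingularities.Cruxes.EquisingularLiftNat.Sections

/-- **The liftable nose class, level 2** (DOWNSTAIRS, inductive, append-only over lead-2's `IsLiftableNoseClass`): `base` = the v1 class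
(smooth complete intersections, smooth determinantal loci, their disjoint unions); `rat` = the zero set `V₊(ker (aeval f))` of the kernel of a
parametrisation `x_i ↦ f_i(s₀..s_r)` by forms of ONE degree `e ≥ 1` satisfying the COFINITE CLAUSE `∀ m ≥ m₀, k[s]_{e m} ≤ aeval f (k[x]_m)`
(«`ℙ^r_k → ℙⁿ_k` is a closed immersion»: r = 1 = smooth RATIONAL CURVES of every degree, ACM or not; general r = Veronese-type images) —
purely algebraic data: no regularity clause (T-RATREG) and no closedness clause (`RatLift.isClosed_setOf_ideal_le`); `union` = disjoint unions. -/
inductive IsLiftableNoseClass₂ (k : Type) [Field k] (n : ℕ) :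
    Set (Literature.AlgebraicGeometry.Motives.projectiveSpace n k).left → Prop
  /-- lead-2's v1 class (ci / det / union). -/
  | base (Z : Set (Literature.AlgebraicGeometry.Motives.projectiveSpace n k).left) :
      IsLiftableNoseClass k n Z → IsLiftableNoseClass₂ k n Z
  /-- images of `ℙ^r_k` under a closed immersion given by forms of one degree (cofinite clause). -/
  | rat (r e m₀ : ℕ) (f : Fin (n + 1) → MvPolynomial (Fin (r + 1)) k)
      (h : (letI := MvPolynomial.gradedAlgebra (σ := Fin (n + 1)) (R := k);
        (∀ i, (f i).IsHomogeneous e) ∧ 0 < e ∧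
        (∀ m, m₀ ≤ m → MvPolynomial.homogeneousSubmodule (Fin (r + 1)) k (e * m) ≤
          (MvPolynomial.homogeneousSubmodule (Fin (n + 1)) k m).map (MvPolynomial.aeval (R := k) f).toLinearMap))) :
      IsLiftableNoseClass₂ k n (letI := MvPolynomial.gradedAlgebra (σ := Fin (n + 1)) (R := k);
        {y : (Literature.AlgebraicGeometry.Motives.projectiveSpace n k).left |
          RingHom.ker (MvPolynomial.aeval (R := k) f) ≤
            (y : ProjectiveSpectrum (MvPolynomial.homogeneousSubmodule (Fin (n + 1)) k)).asHomogeneousIdeal.toIdeal})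
  /-- disjoint unions. -/
  | union (Z₁ Z₂ : Set (Literature.AlgebraicGeometry.Motives.projectiveSpace n k).left) :
      IsLiftableNoseClass₂ k n Z₁ → IsLiftableNoseClass₂ k n Z₂ → Z₁ ∩ Z₂ = ∅ → IsLiftableNoseClass₂ k n (Z₁ ∪ Z₂)

/-- Members of the level-2 class are closed. -/
theorem IsLiftableNoseClass₂.isClosed {k : Type} [Field k] {n : ℕ}
    {Z : Set (Literature.AlgebraicGeometry.Motives.projectiveSpace n k).left} (h : IsLiftableNoseClass₂ k n Z) : IsClosed Z := by
  induction h with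
  | base Z h => exact h.isClosed
  | rat r e m₀ f h => exact RatLift.isClosed_setOf_ideal_le k n _
  | union Z₁ Z₂ _ _ _ ih₁ ih₂ => exact ih₁.union ih₂

end Summit.ResolutionOfSingularities.ResolutionOfSingularities.Cruxes.EquisingularLiftNat.Sections

end
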